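import Literature.Computability.AlgebraicComplexity.FlipGraphEquivariance
import HarnessLib

/-!
# Normal form of KM's symmetry group: a sandwich followed by a permutation of the factors (KM 2023 §2, HKS 2021 §4–5)

Topic `Literature/Computability/AlgebraicComplexity`, over `FlipGraphSymmetry.lean` /
`FlipGraphEquivariance.lean` (the symmetry group `G` of `⟨n,n,n⟩` as the tree types it:
`InSymmetryGroup`, generated under composition and inverses by the sandwiches
`Symmetry.sandwich P Q R` — de Groote's `X ↦ PXQᵀ, Y ↦ Q⁻ᵀYRᵀ, Z ↦ P⁻ᵀZR⁻¹` —, the cyclic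
shift `Symmetry.cycleSq` and the transposition `Symmetry.transposeSq`). Sources: M. Kauers,
J. Moosbauer, *Flip Graphs for Matrix Multiplication*, ISSAC 2023 = arXiv:2212.01175 (KM), §2:
"These transformations generate the symmetry group of `M_{n,m,p}`"; M. Heule, M. Kauers, M. Seidl,
*New ways to multiply `3 × 3`-matrices*, J. Symbolic Comput. 104 (2021) (HKS), §4: the group
`G = GL(K,n)³ × S₃` acting by "`(U,V,W)·(A⊗B⊗C) = UAV⁻¹ ⊗ VBW⁻¹ ⊗ WCU⁻¹`",
"`(1 2)·(A⊗B⊗C) = Bᵀ⊗Aᵀ⊗Cᵀ`", "`(1 2 3)·(A⊗B⊗C) = B⊗C⊗A`" (a semidirect product: the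
permutations normalise the sandwiches), §5: "even for `K = ℤ₂`, the group `G` has `168³·6` elements";
H. F. de Groote, *On varieties of optimal algorithms for the computation of bilinear mappings I*,
TCS 7 (1978), §3 (the sandwich group). Everything here is PROVED; no named facts.

## What is typed

The elementary structure fact behind HKS's description `GL(K,n)³ × S₃` of KM's group, for the
tree's generated group `InSymmetryGroup` (every `n`, every field):

* §1 the two generators normalise the sandwiches — `transposeMap_swAct`:
  `τ ∘ (P,Q,R) = (R, Q⁻ᵀ, P) ∘ τ`, `cycleMap_swAct`: `ρ ∘ (P,Q,R) = (Q⁻ᵀ, R, P⁻ᵀ) ∘ ρ`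
  (on all tensors, via the conjugation rules `transposeMap_actTensor`, `cycleMap_actTensor` of an
  arbitrary factorwise action), and sandwiches compose: `swAct_swAct`
  (`(P,Q,R) ∘ (P',Q',R') = (PP', QQ', RR')`);
* §2 the six words `permMap k` (`1, τ, ρ, τρ, ρ², τρ²`) in the two generators are closed under
  left multiplication by `τ` and `ρ` (`transposeMap_permMap`, `cycleMap_permMap`: the relations
  `τ² = 1`, `ρ³ = 1`, `ρτ = τρ²` on tensors);
* §3 **normal form** — `InSymmetryGroup.exists_normalForm`: every element `g` of KM's group acts as
  `T ↦ σ((P⁻ᵀ ⊗ R⁻ᵀ, P ⊗ Q, Q⁻ᵀ ⊗ R)·T)` for one of the six words `σ` and invertible `P, Q, R`,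
  i.e. `g = (sandwich P Q R) ∘ σ`; as symmetries: `InSymmetryGroup.exists_eq_sandwich_trans_permSym`.
  Consequently `G` is the image of `GL_n(K)³ × S₃` (HKS §4–5; over `ℤ₂` and `n = 3` a set of at most
  `168³ · 6` maps, cf. `SchemeSymmetryGroupOrderF2.lean` for the count `168³ · 6 = 28 449 792`).

HONEST FRAMING: this is the easy inclusion "generated group ⊆ sandwiches ⋊ S₃" for the tree's
generators; de Groote's theorem that these exhaust ALL decomposable automorphisms of `⟨n,n,n⟩`, and
the faithfulness/kernel of `GL³ × S₃ → G` (scalars), are not typed here.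

## References

* M. Kauers, J. Moosbauer, *Flip Graphs for Matrix Multiplication*, ISSAC 2023, 381–388,
  arXiv:2212.01175: §2 (symmetry group). [KauersMoosbauer2022FlipGraphs]
* M. J. H. Heule, M. Kauers, M. Seidl, *New ways to multiply 3 × 3-matrices*, J. Symbolic Comput.
  104 (2021) 899–916, arXiv:1905.10192: §4 (the group `GL(K,n)³ × S₃` and its action), §5
  (`|G| = 168³·6` over `ℤ₂`). [HeuleKauersSeidl2021]
* H. F. de Groote, *On varieties of optimal algorithms for the computation of bilinear mappings. I.
  The isotropy group of a bilinear mapping*, Theoret. Comput. Sci. 7 (1978) 1–24: §3. [Degroote1978]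
-/

set_option Elab.async false

namespace Literature.Computability.AlgebraicComplexity

open scoped BigOperators Kronecker
open Matrix

namespace FlipGraph

variable {K : Type*} [Field K] {n : ℕ}

/-- Local shorthand: the tensor space `K^{(n×n)×(n×n)×(n×n)}` containing `⟨n,n,n⟩`.
[cite: KauersMoosbauer2022FlipGraphs, Def. 1] -/
abbrev Tn (K : Type*) (n : ℕ) : Type _ := (Fin n × Fin n) → (Fin n × Fin n) → (Fin n × Fin n) → K

/-! ## §1 The generators normalise the sandwiches -/

/-- Conjugating a matrix on `Fin n × Fin n` by the index swap `(i,j) ↦ (j,i)` (what the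
transposition of factor matrices does to a factorwise linear map). [folklore] -/
def swc (M : Matrix (Fin n × Fin n) (Fin n × Fin n) K) : Matrix (Fin n × Fin n) (Fin n × Fin n) K :=
  fun p q => M p.swap q.swap

/-- The swap conjugate of a Kronecker product is the Kronecker product in the other order:
`(A ⊗ B)_{(j,i),(l,k)} = (B ⊗ A)_{(i,j),(k,l)}`. [folklore] -/
private theorem swc_kronecker (A B : Matrix (Fin n) (Fin n) K) : swc (A ⊗ₖ B) = B ⊗ₖ A := by
  ext p q
  simp [swc, Matrix.kroneckerMap_apply, mul_comm]

/-- **The transposition conjugates a factorwise action:**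
`τ((A ⊗ B ⊗ C)·T) = (swc A ⊗ swc C ⊗ swc B)·(τ T)` (slots `(Z,X,Y)`; `τ` exchanges the `X`- and
`Y`-slots and transposes all three factors). [cite: HeuleKauersSeidl2021, §4 ("(1 2)·(A⊗B⊗C) = Bᵀ⊗Aᵀ⊗Cᵀ")] -/
theorem transposeMap_actTensor (A B C : Matrix (Fin n × Fin n) (Fin n × Fin n) K) (T : Tn K n) :
    transposeMap n (actTensor A B C T) = actTensor (swc A) (swc C) (swc B) (transposeMap n T) := by
  funext a b c
  simp only [transposeMap, actTensor_apply, swc]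
  -- reindex the three bound variables by the index swap and exchange the two inner sums
  rw [← (Equiv.prodComm (Fin n) (Fin n)).sum_comp]
  refine Finset.sum_congr rfl fun x _ => ?_
  rw [Finset.sum_comm, ← (Equiv.prodComm (Fin n) (Fin n)).sum_comp]
  refine Finset.sum_congr rfl fun y _ => ?_
  rw [← (Equiv.prodComm (Fin n) (Fin n)).sum_comp]
  refine Finset.sum_congr rfl fun z _ => ?_
  simp only [Equiv.prodComm_apply]
  ring

/-- **The cyclic shift conjugates a factorwise action:**
`ρ((A ⊗ B ⊗ C)·T) = (swc B ⊗ C ⊗ swc A)·(ρ T)` (slots `(Z,X,Y)`).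
[cite: HeuleKauersSeidl2021, §4 ("(1 2 3)·(A⊗B⊗C) = B⊗C⊗A")] -/
theorem cycleMap_actTensor (A B C : Matrix (Fin n × Fin n) (Fin n × Fin n) K) (T : Tn K n) :
    cycleMap n (actTensor A B C T) = actTensor (swc B) C (swc A) (cycleMap n T) := by
  funext a b c
  simp only [cycleMap, actTensor_apply, swc]
  -- LHS: Σ_{a' b' c'} A c.swap a' * B a.swap b' * C b c' * T a' b' c'
  -- RHS: Σ_{x y z} B a.swap x.swap * C b y * A c.swap z.swap * T z.swap x.swap y
  rw [Finset.sum_comm, ← (Equiv.prodComm (Fin n) (Fin n)).sum_comp]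
  refine Finset.sum_congr rfl fun x _ => ?_
  rw [Finset.sum_comm]
  refine Finset.sum_congr rfl fun y _ => ?_
  rw [← (Equiv.prodComm (Fin n) (Fin n)).sum_comp]
  refine Finset.sum_congr rfl fun z _ => ?_
  simp only [Equiv.prodComm_apply]
  ring

/-- For invertible `Q`: `((Q⁻¹)ᵀ)⁻¹)ᵀ = Q` (bookkeeping). [folklore] -/
private theorem invT_invT (Q : Matrix (Fin n) (Fin n) K) (hQ : IsUnit Q.det) : Q⁻¹ᵀ⁻¹ᵀ = Q := by
  rw [← transpose_nonsing_inv, nonsing_inv_nonsing_inv _ hQ, transpose_transpose]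

/-- For invertible `Q`: `(Q⁻¹)ᵀ` is invertible (bookkeeping). [folklore] -/
private theorem isUnit_det_invT {Q : Matrix (Fin n) (Fin n) K} (hQ : IsUnit Q.det) :
    IsUnit Q⁻¹ᵀ.det := by
  rw [det_transpose]; exact isUnit_nonsing_inv_det _ hQ

/-- **The sandwich action as a function on tensors** (the tree's `Symmetry.sandwich P Q R` acts by
it): `T ↦ (P⁻ᵀ ⊗ R⁻ᵀ, P ⊗ Q, Q⁻ᵀ ⊗ R)·T`, i.e. `X ↦ PXQᵀ`, `Y ↦ Q⁻ᵀYRᵀ`, `Z ↦ P⁻ᵀZR⁻¹`.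
[cite: Degroote1978, §3] -/
noncomputable def swAct (P Q R : Matrix (Fin n) (Fin n) K) (T : Tn K n) : Tn K n :=
  actTensor (P⁻¹ᵀ ⊗ₖ R⁻¹ᵀ) (P ⊗ₖ Q) (Q⁻¹ᵀ ⊗ₖ R) T

/-- The tree's sandwich symmetry acts by `swAct`. [cite: Degroote1978, §3] -/
theorem sandwich_apply (P Q R : Matrix (Fin n) (Fin n) K) (hP : IsUnit P.det) (hQ : IsUnit Q.det)
    (hR : IsUnit R.det) (T : Tn K n) :
    (Symmetry.sandwich P Q R hP hQ hR).toLinearEquiv T = swAct P Q R T := rfl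

/-- … and its inverse by the sandwich of the inverses. [cite: Degroote1978, §3] -/
theorem sandwich_symm_apply (P Q R : Matrix (Fin n) (Fin n) K) (hP : IsUnit P.det)
    (hQ : IsUnit Q.det) (hR : IsUnit R.det) (T : Tn K n) :
    (Symmetry.sandwich P Q R hP hQ hR).toLinearEquiv.symm T = swAct P⁻¹ Q⁻¹ R⁻¹ T := by
  show actTensor (Pᵀ ⊗ₖ Rᵀ) (P⁻¹ ⊗ₖ Q⁻¹) (Qᵀ ⊗ₖ R⁻¹) T = _
  rw [swAct, nonsing_inv_nonsing_inv _ hP, nonsing_inv_nonsing_inv _ hQ,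
    nonsing_inv_nonsing_inv _ hR]

/-- **Sandwiches compose:** `(P,Q,R) ∘ (P',Q',R') = (PP', QQ', RR')`.
[cite: HeuleKauersSeidl2021, §4 (the group `GL(K,n)³`)] -/
theorem swAct_swAct (P Q R P' Q' R' : Matrix (Fin n) (Fin n) K) (T : Tn K n) :
    swAct P Q R (swAct P' Q' R' T) = swAct (P * P') (Q * Q') (R * R') T := by
  rw [swAct, swAct, swAct, actTensor_actTensor, ← mul_kronecker_mul, ← mul_kronecker_mul,
    ← mul_kronecker_mul, mul_inv_rev P P', mul_inv_rev Q Q', mul_inv_rev R R', transpose_mul,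
    transpose_mul, transpose_mul]

/-- The identity sandwich acts trivially. [cite: Degroote1978, §3] -/
theorem swAct_one (T : Tn K n) : swAct (1 : Matrix (Fin n) (Fin n) K) 1 1 T = T := by
  rw [swAct, inv_one, transpose_one, one_kronecker_one, actTensor_one]

/-- **`τ ∘ (P,Q,R) = (R, Q⁻ᵀ, P) ∘ τ`** on all tensors. [cite: HeuleKauersSeidl2021, §4] -/
theorem transposeMap_swAct (P Q R : Matrix (Fin n) (Fin n) K) (hQ : IsUnit Q.det) (T : Tn K n) :
    transposeMap n (swAct P Q R T) = swAct R Q⁻¹ᵀ P (transposeMap n T) := by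
  rw [swAct, transposeMap_actTensor, swc_kronecker, swc_kronecker, swc_kronecker, swAct,
    invT_invT Q hQ]

/-- **`ρ ∘ (P,Q,R) = (Q⁻ᵀ, R, P⁻ᵀ) ∘ ρ`** on all tensors. [cite: HeuleKauersSeidl2021, §4] -/
theorem cycleMap_swAct (P Q R : Matrix (Fin n) (Fin n) K) (hP : IsUnit P.det) (hQ : IsUnit Q.det)
    (T : Tn K n) : cycleMap n (swAct P Q R T) = swAct Q⁻¹ᵀ R P⁻¹ᵀ (cycleMap n T) := by
  rw [swAct, cycleMap_actTensor, swc_kronecker, swc_kronecker, swAct, invT_invT Q hQ,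
    invT_invT P hP]

/-- The other way round: **`(P,Q,R) ∘ τ = τ ∘ (R, Q⁻ᵀ, P)`**. [cite: HeuleKauersSeidl2021, §4] -/
theorem swAct_transposeMap (P Q R : Matrix (Fin n) (Fin n) K) (hQ : IsUnit Q.det) (T : Tn K n) :
    swAct P Q R (transposeMap n T) = transposeMap n (swAct R Q⁻¹ᵀ P T) := by
  rw [transposeMap_swAct R Q⁻¹ᵀ P (isUnit_det_invT hQ) T, invT_invT Q hQ]

/-- The other way round: **`(P,Q,R) ∘ ρ = ρ ∘ (R⁻ᵀ, P⁻ᵀ, Q)`**. [cite: HeuleKauersSeidl2021, §4] -/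
theorem swAct_cycleMap (P Q R : Matrix (Fin n) (Fin n) K) (hP : IsUnit P.det) (hR : IsUnit R.det)
    (T : Tn K n) : swAct P Q R (cycleMap n T) = cycleMap n (swAct R⁻¹ᵀ P⁻¹ᵀ Q T) := by
  rw [cycleMap_swAct _ _ _ (isUnit_det_invT hR) (isUnit_det_invT hP), invT_invT P hP,
    invT_invT R hR]

/-! ## §2 The six words in the two generators -/

/-- The six words `1, τ, ρ, τρ, ρ², τρ²` (as maps on tensors; `k ≥ 6`: the identity).
[cite: HeuleKauersSeidl2021, §4 (the factor `S₃`)] -/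
def permMap (n : ℕ) (k : ℕ) (T : Tn K n) : Tn K n :=
  match k with
  | 0 => T
  | 1 => transposeMap n T
  | 2 => cycleMap n T
  | 3 => transposeMap n (cycleMap n T)
  | 4 => cycleMap n (cycleMap n T)
  | 5 => transposeMap n (cycleMap n (cycleMap n T))
  | _ => T

/-- Left multiplication table of `τ` on the six words. [folklore] -/
def tauK : ℕ → ℕ
  | 0 => 1 | 1 => 0 | 2 => 3 | 3 => 2 | 4 => 5 | 5 => 4 | _ => 1

/-- Left multiplication table of `ρ` on the six words. [folklore] -/
def rhoK : ℕ → ℕ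
  | 0 => 2 | 1 => 5 | 2 => 4 | 3 => 1 | 4 => 0 | 5 => 3 | _ => 2

/-- `tauK` stays below `6`. [folklore] -/
private theorem tauK_lt (k : ℕ) : tauK k < 6 := by
  rcases k with _ | _ | _ | _ | _ | _ | _ <;> simp [tauK]

/-- `rhoK` stays below `6`. [folklore] -/
private theorem rhoK_lt (k : ℕ) : rhoK k < 6 := by
  rcases k with _ | _ | _ | _ | _ | _ | _ <;> simp [rhoK]

omit [Field K] in
/-- `τ² = 1` on tensors. [cite: HeuleKauersSeidl2021, §4] -/
private theorem transposeMap_transposeMap (T : Tn K n) : transposeMap n (transposeMap n T) = T := by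
  funext a b c; simp [transposeMap]

omit [Field K] in
/-- `ρ³ = 1` on tensors. [cite: HeuleKauersSeidl2021, §4] -/
private theorem cycleMap_pow_three (T : Tn K n) :
    cycleMap n (cycleMap n (cycleMap n T)) = T := by
  funext a b c; simp [cycleMap]

omit [Field K] in
/-- `ρτ = τρ²` on tensors. [cite: HeuleKauersSeidl2021, §4] -/
private theorem cycleMap_transposeMap (T : Tn K n) :
    cycleMap n (transposeMap n T) = transposeMap n (cycleMap n (cycleMap n T)) := by
  funext a b c; simp [cycleMap, transposeMap]

omit [Field K] in
/-- **`τ ∘ word_k = word_{τk}`.** [cite: HeuleKauersSeidl2021, §4] -/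
theorem transposeMap_permMap (k : ℕ) (T : Tn K n) :
    transposeMap n (permMap n k T) = permMap n (tauK k) T := by
  rcases k with _ | _ | _ | _ | _ | _ | _ <;>
    simp only [permMap, tauK, transposeMap_transposeMap]

omit [Field K] in
/-- **`ρ ∘ word_k = word_{ρk}`.** [cite: HeuleKauersSeidl2021, §4] -/
theorem cycleMap_permMap (k : ℕ) (T : Tn K n) :
    cycleMap n (permMap n k T) = permMap n (rhoK k) T := by
  rcases k with _ | _ | _ | _ | _ | _ | _ <;>
    simp only [permMap, rhoK, cycleMap_transposeMap, cycleMap_pow_three]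

omit [Field K] in
/-- The words are closed under composition. [cite: HeuleKauersSeidl2021, §4] -/
theorem permMap_permMap (k' k : ℕ) : ∃ k'', k'' < 6 ∧ ∀ T : Tn K n,
    permMap n k' (permMap n k T) = permMap n k'' T := by
  rcases k' with _ | _ | _ | _ | _ | _ | _
  · rcases Nat.lt_or_ge k 6 with hk | hk
    · exact ⟨k, hk, fun T => rfl⟩
    · refine ⟨0, by omega, fun T => ?_⟩
      obtain ⟨m, rfl⟩ := Nat.exists_eq_add_of_le hk
      rw [show 6 + m = (m + 6) from by omega]; rfl
  · exact ⟨tauK k, tauK_lt k, fun T => transposeMap_permMap k T⟩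
  · exact ⟨rhoK k, rhoK_lt k, fun T => cycleMap_permMap k T⟩
  · exact ⟨tauK (rhoK k), tauK_lt _, fun T => by
      show transposeMap n (cycleMap n (permMap n k T)) = _
      rw [cycleMap_permMap, transposeMap_permMap]⟩
  · exact ⟨rhoK (rhoK k), rhoK_lt _, fun T => by
      show cycleMap n (cycleMap n (permMap n k T)) = _
      rw [cycleMap_permMap, cycleMap_permMap]⟩
  · exact ⟨tauK (rhoK (rhoK k)), tauK_lt _, fun T => by
      show transposeMap n (cycleMap n (cycleMap n (permMap n k T))) = _
      rw [cycleMap_permMap, cycleMap_permMap, transposeMap_permMap]⟩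
  · rcases Nat.lt_or_ge k 6 with hk | hk
    · exact ⟨k, hk, fun T => rfl⟩
    · refine ⟨0, by omega, fun T => ?_⟩
      obtain ⟨m, rfl⟩ := Nat.exists_eq_add_of_le hk
      rw [show 6 + m = (m + 6) from by omega]; rfl

/-- **A sandwich passes through a word:** `(P,Q,R) ∘ σ_k = σ_k ∘ (P',Q',R')` for suitable invertible
`P', Q', R'` (the semidirect-product structure). [cite: HeuleKauersSeidl2021, §4] -/
theorem swAct_permMap (k : ℕ) (P Q R : Matrix (Fin n) (Fin n) K) (hP : IsUnit P.det)
    (hQ : IsUnit Q.det) (hR : IsUnit R.det) :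
    ∃ P' Q' R' : Matrix (Fin n) (Fin n) K, IsUnit P'.det ∧ IsUnit Q'.det ∧ IsUnit R'.det ∧
      ∀ T : Tn K n, swAct P Q R (permMap n k T) = permMap n k (swAct P' Q' R' T) := by
  have hT : ∀ {M : Matrix (Fin n) (Fin n) K}, IsUnit M.det → IsUnit M⁻¹ᵀ.det := fun h =>
    isUnit_det_invT h
  -- one `τ`-step and one `ρ`-step, with their unit bookkeeping
  have stepτ : ∀ (P Q R : Matrix (Fin n) (Fin n) K), IsUnit P.det → IsUnit Q.det → IsUnit R.det →
      ∀ S : Tn K n, swAct P Q R (transposeMap n S) = transposeMap n (swAct R Q⁻¹ᵀ P S) :=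
    fun P Q R _ hQ _ S => swAct_transposeMap P Q R hQ S
  have stepρ : ∀ (P Q R : Matrix (Fin n) (Fin n) K), IsUnit P.det → IsUnit Q.det → IsUnit R.det →
      ∀ S : Tn K n, swAct P Q R (cycleMap n S) = cycleMap n (swAct R⁻¹ᵀ P⁻¹ᵀ Q S) :=
    fun P Q R hP _ hR S => swAct_cycleMap P Q R hP hR S
  rcases k with _ | _ | _ | _ | _ | _ | _
  · exact ⟨P, Q, R, hP, hQ, hR, fun T => rfl⟩
  · exact ⟨R, Q⁻¹ᵀ, P, hR, hT hQ, hP, fun T => stepτ P Q R hP hQ hR T⟩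
  · exact ⟨R⁻¹ᵀ, P⁻¹ᵀ, Q, hT hR, hT hP, hQ, fun T => stepρ P Q R hP hQ hR T⟩
  · refine ⟨P⁻¹ᵀ, R⁻¹ᵀ, Q⁻¹ᵀ, hT hP, hT hR, hT hQ, fun T => ?_⟩
    show swAct P Q R (transposeMap n (cycleMap n T)) = transposeMap n (cycleMap n _)
    rw [stepτ P Q R hP hQ hR, stepρ R Q⁻¹ᵀ P hR (hT hQ) hP]
  · refine ⟨Q⁻¹ᵀ, R, P⁻¹ᵀ, hT hQ, hR, hT hP, fun T => ?_⟩
    show swAct P Q R (cycleMap n (cycleMap n T)) = cycleMap n (cycleMap n _)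
    rw [stepρ P Q R hP hQ hR, stepρ R⁻¹ᵀ P⁻¹ᵀ Q (hT hR) (hT hP) hQ, invT_invT R hR]
  · refine ⟨Q, P, R⁻¹ᵀ, hQ, hP, hT hR, fun T => ?_⟩
    show swAct P Q R (transposeMap n (cycleMap n (cycleMap n T))) =
      transposeMap n (cycleMap n (cycleMap n _))
    rw [stepτ P Q R hP hQ hR, stepρ R Q⁻¹ᵀ P hR (hT hQ) hP,
      stepρ P⁻¹ᵀ R⁻¹ᵀ Q⁻¹ᵀ (hT hP) (hT hR) (hT hQ), invT_invT Q hQ, invT_invT P hP]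
  · exact ⟨P, Q, R, hP, hQ, hR, fun T => rfl⟩

/-! ## §3 The normal form -/

/-- **Normal form predicate** for a map on tensors: `T ↦ σ_k((P,Q,R)·T)` for a word `k < 6` and
invertible `P, Q, R`. [cite: HeuleKauersSeidl2021, §4 (`G = GL(K,n)³ × S₃`)] -/
def IsNF (f : Tn K n → Tn K n) : Prop :=
  ∃ k, k < 6 ∧ ∃ P Q R : Matrix (Fin n) (Fin n) K, IsUnit P.det ∧ IsUnit Q.det ∧ IsUnit R.det ∧
    ∀ T, f T = permMap n k (swAct P Q R T)

/-- Normal forms compose. [cite: HeuleKauersSeidl2021, §4] -/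
theorem IsNF.comp {f g : Tn K n → Tn K n} (hf : IsNF f) (hg : IsNF g) : IsNF (g ∘ f) := by
  obtain ⟨k, hk, P, Q, R, hP, hQ, hR, hfT⟩ := hf
  obtain ⟨k', hk', P', Q', R', hP', hQ', hR', hgT⟩ := hg
  -- `g (f T) = σ_{k'} ((P',Q',R') (σ_k ((P,Q,R) T))) = σ_{k'} (σ_k ((P'',Q'',R'') ((P,Q,R) T)))`
  obtain ⟨P'', Q'', R'', hP'', hQ'', hR'', hcomm⟩ := swAct_permMap k P' Q' R' hP' hQ' hR'
  obtain ⟨k'', hk'', hword⟩ := permMap_permMap (K := K) (n := n) k' k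
  refine ⟨k'', hk'', P'' * P, Q'' * Q, R'' * R, ?_, ?_, ?_, fun T => ?_⟩
  · rw [det_mul]; exact hP''.mul hP
  · rw [det_mul]; exact hQ''.mul hQ
  · rw [det_mul]; exact hR''.mul hR
  · rw [Function.comp_apply, hfT, hgT, hcomm, hword, swAct_swAct]

/-- A sandwich is in normal form. [cite: Degroote1978, §3] -/
theorem isNF_swAct (P Q R : Matrix (Fin n) (Fin n) K) (hP : IsUnit P.det) (hQ : IsUnit Q.det)
    (hR : IsUnit R.det) : IsNF (swAct P Q R) :=
  ⟨0, by omega, P, Q, R, hP, hQ, hR, fun _ => rfl⟩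

/-- `1 ∈ GL_n` (bookkeeping). [folklore] -/
private theorem isUnit_det_one' : IsUnit (1 : Matrix (Fin n) (Fin n) K).det := by
  rw [det_one]; exact isUnit_one

/-- A word is in normal form (identity sandwich). [cite: HeuleKauersSeidl2021, §4] -/
theorem isNF_permMap (k : ℕ) (hk : k < 6) : IsNF (permMap (K := K) n k) :=
  ⟨k, hk, 1, 1, 1, isUnit_det_one', isUnit_det_one', isUnit_det_one', fun T => by rw [swAct_one]⟩

/-- **Normal form theorem (HKS §4's `GL(K,n)³ × S₃` for KM's generated group):** every element `g` of
KM's symmetry group `G` of `⟨n,n,n⟩` — generated by the sandwiches, the cyclic shift and the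
transposition under composition and inverses — acts on ALL tensors as a sandwich followed by one of
the six words: `g(T) = σ_k((P⁻ᵀ ⊗ R⁻ᵀ, P ⊗ Q, Q⁻ᵀ ⊗ R)·T)`, and so does `g⁻¹`.
[cite: HeuleKauersSeidl2021, §4; KM §2 ("These transformations generate the symmetry group")] -/
theorem InSymmetryGroup.isNF_and_isNF_symm {φ : Symmetry (matMulTensor K n n n)}
    (hφ : InSymmetryGroup φ) :
    IsNF (fun T => φ.toLinearEquiv T) ∧ IsNF (fun T => φ.toLinearEquiv.symm T) := by
  induction hφ with
  | sandwich P Q R hP hQ hR =>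
    refine ⟨isNF_swAct P Q R hP hQ hR, ?_⟩
    have h : (fun T => (Symmetry.sandwich P Q R hP hQ hR).toLinearEquiv.symm T) =
        swAct P⁻¹ Q⁻¹ R⁻¹ := funext fun T => sandwich_symm_apply P Q R hP hQ hR T
    rw [h]
    exact isNF_swAct _ _ _ (isUnit_nonsing_inv_det _ hP) (isUnit_nonsing_inv_det _ hQ)
      (isUnit_nonsing_inv_det _ hR)
  | cycle =>
    refine ⟨isNF_permMap 2 (by omega), ?_⟩
    -- `ρ⁻¹ = ρ²`
    have h : (fun T : Tn K n => (Symmetry.cycleSq (K := K) n).toLinearEquiv.symm T) =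
        permMap n 4 := by
      funext T; funext a b c
      show cycleMapInv n T a b c = cycleMap n (cycleMap n T) a b c
      simp [cycleMapInv, cycleMap]
    rw [h]; exact isNF_permMap 4 (by omega)
  | transpose =>
    exact ⟨isNF_permMap 1 (by omega), isNF_permMap 1 (by omega)⟩
  | refl =>
    exact ⟨isNF_permMap 0 (by omega), isNF_permMap 0 (by omega)⟩
  | @symm φ _ ih =>
    refine ⟨ih.2, ?_⟩
    change IsNF (fun T => φ.toLinearEquiv.symm.symm T)
    simpa only [LinearEquiv.symm_symm] using ih.1
  | trans _ _ ihφ ihψ =>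
    exact ⟨ihφ.1.comp ihψ.1, ihψ.2.comp ihφ.2⟩

/-- **Normal form, stated:** for `g ∈ G` there are a word `k < 6` and invertible `P, Q, R` with
`g(T) = σ_k((P⁻ᵀ ⊗ R⁻ᵀ, P ⊗ Q, Q⁻ᵀ ⊗ R)·T)` for every tensor `T`.
[cite: HeuleKauersSeidl2021, §4] -/
theorem InSymmetryGroup.exists_normalForm {φ : Symmetry (matMulTensor K n n n)}
    (hφ : InSymmetryGroup φ) :
    ∃ k, k < 6 ∧ ∃ P Q R : Matrix (Fin n) (Fin n) K, IsUnit P.det ∧ IsUnit Q.det ∧ IsUnit R.det ∧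
      ∀ T, φ.toLinearEquiv T = permMap n k (actTensor (P⁻¹ᵀ ⊗ₖ R⁻¹ᵀ) (P ⊗ₖ Q) (Q⁻¹ᵀ ⊗ₖ R) T) :=
  hφ.isNF_and_isNF_symm.1

/-- The six words as symmetries of `⟨n,n,n⟩` (`1, τ, ρ, ρ∘τ, ρ², ρ²∘τ` read left to right as
`Symmetry.trans`, matching `permMap`). [cite: KauersMoosbauer2022FlipGraphs, §2 (symmetry group)] -/
def permSym (K : Type*) [Field K] (n : ℕ) (k : ℕ) : Symmetry (matMulTensor K n n n) :=
  match k with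
  | 0 => Symmetry.refl _
  | 1 => Symmetry.transposeSq n
  | 2 => Symmetry.cycleSq n
  | 3 => (Symmetry.cycleSq n).trans (Symmetry.transposeSq n)
  | 4 => (Symmetry.cycleSq n).trans (Symmetry.cycleSq n)
  | 5 => ((Symmetry.cycleSq n).trans (Symmetry.cycleSq n)).trans (Symmetry.transposeSq n)
  | _ => Symmetry.refl _

/-- The word symmetries belong to `G`. [cite: KauersMoosbauer2022FlipGraphs, §2 (symmetry group)] -/
theorem inSymmetryGroup_permSym (k : ℕ) : InSymmetryGroup (permSym K n k) := by
  rcases k with _ | _ | _ | _ | _ | _ | _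
  · exact InSymmetryGroup.refl
  · exact InSymmetryGroup.transpose
  · exact InSymmetryGroup.cycle
  · exact InSymmetryGroup.cycle.trans InSymmetryGroup.transpose
  · exact InSymmetryGroup.cycle.trans InSymmetryGroup.cycle
  · exact (InSymmetryGroup.cycle.trans InSymmetryGroup.cycle).trans InSymmetryGroup.transpose
  · exact InSymmetryGroup.refl

/-- The word symmetries act by `permMap`. [cite: KauersMoosbauer2022FlipGraphs, §2 (symmetry group)] -/
theorem permSym_apply (k : ℕ) (T : Tn K n) : (permSym K n k).toLinearEquiv T = permMap n k T := by
  rcases k with _ | _ | _ | _ | _ | _ | _ <;> rfl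

/-- **Normal form as an identity of symmetries:** every `g ∈ G` has the same underlying linear map
as `(sandwich P Q R) ∘ σ_k` for some word `k < 6` and invertible `P, Q, R` — the surjection
`GL_n(K)³ × S₃ ↠ G` of HKS §4–5 (`|G| ≤ 6·|GL_n(K)|³`; "`168³ · 6`" names for `n = 3`, `K = ℤ₂`).
[cite: HeuleKauersSeidl2021, §4–§5] -/
theorem InSymmetryGroup.exists_eq_sandwich_trans_permSym {φ : Symmetry (matMulTensor K n n n)}
    (hφ : InSymmetryGroup φ) :
    ∃ k, k < 6 ∧ ∃ (P Q R : Matrix (Fin n) (Fin n) K) (hP : IsUnit P.det) (hQ : IsUnit Q.det)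
      (hR : IsUnit R.det),
      φ.toLinearEquiv = ((Symmetry.sandwich P Q R hP hQ hR).trans (permSym K n k)).toLinearEquiv := by
  obtain ⟨k, hk, P, Q, R, hP, hQ, hR, h⟩ := hφ.exists_normalForm
  refine ⟨k, hk, P, Q, R, hP, hQ, hR, LinearEquiv.ext fun T => ?_⟩
  rw [h T]
  show _ = (permSym K n k).toLinearEquiv ((Symmetry.sandwich P Q R hP hQ hR).toLinearEquiv T)
  rw [permSym_apply, sandwich_apply, swAct]

end FlipGraph

end Literature.Computability.AlgebraicComplexity
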